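import Summits.Ventures.HSemireg.WedgeBoxPurityRank

/-!
# Venture HSemireg — the degree-n rank of the box for an arbitrary 2×2 pattern (1/2): the three pieces

HONEST FRAMING. Part of the Lean index of the computation cell `pub-hsemireg` (second enclosure wave, cut by seat p6 in the
conventions of seat p3's ENCLOSURE-PLAN-p3.md / build.py from th-7's kernel assets).  Finite-dimensional exterior algebra over a field ONLY:
no variety, no cohomology theory, no semiregularity map is constructed here; nothing here says that HC / HC_CM / HC_AV holds;
no Literature fact is declared or used.  The geometric DICTIONARY (why these ranks are the `HT`-side box ranks of the cell's
STRUCTURE.md §1 / theory/FORMULA-N.md) lives in theory/FORMULA-N-th7.md PART B §A.3 / §N and is NOT asserted in Lean.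

th-7's PART G — THE DEGREE-`n` RANK FOR AN ARBITRARY `2 × 2` COEFFICIENT PATTERN (theory/th7/WeilPurity.lean v6 sha256/16 32700a71e785aa92 (th-7 g6, 23:55Z 2026-08-22; = v5 4d7ab5385cc785fa + PART G two-zero corollaries + PART W3 (= v5.1 f732a146a33beda5) + PART R4; ×2 farm + negative controls + numerics at p6 g7), the block between
Part V's `end PurityGeneral` and `end HSemiregBox`), VERBATIM up to the namespace (`HSemiregBox` ↦ `Summit.Ventures.HSemireg.WedgeBox`), file 1 of 2.
STATEMENT (file 2, `finrank_range_wedgeMap_hbox_pattern (hn : 0 < n)`): for `v = Σ_{α,β} c_{αβ} · E_{A_α} ∧ E_{C_β}` with ANY `c` (zeros allowed),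
`finrank range(θ ↦ θ ∧ v ∣ ⋀ⁿ(K^{4n})) = N(c)·(C(2n,n) − 2) + 2·rank(c)`, `N(c) = #{(α,β) : c_{αβ} ≠ 0}` (every field, every `n ≥ 1`); it CONTAINS Part V
(`…_pattern_generic`: all four non-zero) and closes the rows without exceptional locus: `…_hbox_one_zero` (exactly one zero ⇒ `rank + 2 = 3·C(2n,n)`),
`…_hbox_antidiag` (pure Weil pair), `…_hbox_row_zero` (one-sided rank-one h-part).  Mechanism (sign-free): live mixed monomials give `N(c)` classes of
`C(2n,n) − 2` independent single-term images; the four whole blocks map into the two triple-monomial planes with `2 × 2` coefficient matrices of rank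
`rank(c)`; the three pieces sit on disjoint sets of basis monomials.  This file (sections GeneralPattern, part 1): mixed relevant monomials and their unique disjoint pair, the live family `JM`/`JMc`/`vecM`, `vecM_linearIndependent`, the three pieces of the range (`RA`, `RC`, `range_hbox_eq_sup`), **`finrank_range_hbox_eq_three`**.
-/

open Module Set Set.powersetCard

namespace Summit.Ventures.HSemireg.WedgeBox

variable (K : Type*) [Field K] {n : ℕ}

/-! ## PART G (th-7 g6, 2026-08-22/23): THE DEGREE-`n` RANK FOR AN ARBITRARY `2 × 2` COEFFICIENT PATTERN.
For `v = Σ_{α,β} c_{αβ} · E_{A_α} ∧ E_{C_β}` with ANY `c` (zeros allowed) the rank of `θ ↦ θ ∧ v` on `⋀^n(K^{4n})` is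

  `N(c) · (C(2n,n) − 2) + 2 · rank(c)`,   `N(c) = #{(α,β) : c_{αβ} ≠ 0}`   (every field, every `n ≥ 1`).

Mechanism: a MIXED relevant monomial `s ⊆ A_a ∪ C_b` (meeting both blocks) has a SINGLE-TERM image `± c_{other a, other b} · E_{s ∪ P}`
with its own pivot monomial, live iff that coefficient is non-zero (`N(c)` classes of `C(2n,n) − 2` monomials each); the four whole
blocks `A_0, A_1` / `C_0, C_1` map into the planes of the two `A`-side / `C`-side triple monomials with coefficient matrices
`diag(1, (−1)^{n·n}) · (row-swapped c) · diag(units)` / the same with `cᵀ`, each of rank `rank(c)`; the three pieces live on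
pairwise disjoint sets of basis monomials. Part V (`finrank_range_wedgeMap_hbox_degree_n`, all `c_{αβ} ≠ 0`) is the case `N = 4`;
the new closed cases `N = 3` (exactly one zero: `3·C(2n,n) − 2`, NO exceptional locus) are the models of the RANK-ONE h-part
`c₁e^{λΘ} + a·vol U₊ + b·vol U₋` (W-PURITY(1)) and of the ONE-SIDED two-exponential class `c₁e^{λΘ} + c₂e^{μΘ} + b·vol U₋` at the
middle degree. Sign-free as everywhere in this file. Nothing here bears on HC / HC_CM / HC_AV. -/

section GeneralPattern

variable {k : ℕ} (c : Fin 2 → Fin 2 → K)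

/-! #### Mixed relevant monomials have a unique disjoint pair and single-term images. -/

/-- a mixed relevant monomial (class `Mix n k p`) is a relevant monomial. -/
lemma Mix_subset_Rel {p : Fin 2 × Fin 2} {s : Finset (I n)} (hs : s ∈ Mix n k p) : s ∈ Rel n k :=
  mem_Rel.mpr (Or.inl ⟨p, hs⟩)

/-- a mixed monomial of `A_a ∪ C_b` is disjoint from `P α β` only for `(α, β) = (other a, other b)`. -/
lemma pair_eq_of_mem_Mix {p : Fin 2 × Fin 2} {s : Finset (I n)} (hs : s ∈ Mix n k p) {α β : Fin 2}
    (hd : Disjoint s (P n α β)) : α = other p.1 ∧ β = other p.2 := by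
  obtain ⟨i, hi, hiA⟩ := exists_mem_A_of_mem_Mix hs
  obtain ⟨j, hj, hjC⟩ := exists_mem_C_of_mem_Mix hs
  rw [disjoint_P_iff] at hd
  constructor
  · apply eq_other_of_ne
    intro h
    rw [h] at hd
    exact Finset.disjoint_left.mp hd.1 hi hiA
  · apply eq_other_of_ne
    intro h
    rw [h] at hd
    exact Finset.disjoint_left.mp hd.2 hj hjC

/-- the canonical pair of a mixed monomial of `A_a ∪ C_b` is `(other a, other b)`. -/
lemma canon_of_mem_Mix {p : Fin 2 × Fin 2} {s : Finset (I n)} (hs : s ∈ Mix n k p) :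
    αc s = other p.1 ∧ βc s = other p.2 :=
  pair_eq_of_mem_Mix hs (disjoint_P_canonical (Mix_subset_Rel hs))

/-- SINGLE-TERM IMAGE: for a mixed relevant `s`, `E_s ∧ v = pivCoeff · E_{piv}` (any coefficient matrix). -/
lemma vec_eq_of_mem_Mix (c' : Fin 2 → Fin 2 → K) {p : Fin 2 × Fin 2} (s : Rel n k) (hs : s.1 ∈ Mix n k p) :
    vec K c' s = pivCoeff K c' s • B K n (piv s) := by
  rw [vec, B_mul_boxClass]
  have h1 : ∀ α β, ¬ (α = αc s.1 ∧ β = βc s.1) →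
      (c' α β * sgn K (relPc s) (Ppc n α β)) • B K n ((relPc (n := n) s).val ∪ P n α β) = 0 := by
    intro α β hne
    rw [sgn_of_not_disjoint K, mul_zero, zero_smul]
    intro hd
    apply hne
    have h2 := pair_eq_of_mem_Mix hs hd
    have h3 := canon_of_mem_Mix hs
    exact ⟨h2.1.trans h3.1.symm, h2.2.trans h3.2.symm⟩
  rw [Fintype.sum_eq_single (αc s.1) (fun α hα => Finset.sum_eq_zero fun β _ => h1 α β (fun h => hα h.1)),
    Fintype.sum_eq_single (βc s.1) (fun β hβ => h1 _ β (fun h => hβ h.2))]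
  rfl

/-! #### The live mixed family. -/

variable (n) in
/-- the mixed relevant monomials of degree `n`. -/
noncomputable def JM : Finset (Finset (I n)) := Finset.univ.biUnion (Mix n n)

/-- membership in the live-candidate family `JM`: `s ∈ Mix n n p` for some pair `p`. -/
lemma mem_JM {s : Finset (I n)} : s ∈ JM n ↔ ∃ p, s ∈ Mix n n p := by
  simp only [JM, Finset.mem_biUnion, Finset.mem_univ, true_and]

/-- a `JM`-monomial is not a whole `A`-block. -/
lemma ne_A_of_mem_JM {s : Finset (I n)} (hs : s ∈ JM n) (α : Fin 2) : s ≠ A n α := by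
  obtain ⟨p, hp⟩ := mem_JM.mp hs
  obtain ⟨j, hj, hjC⟩ := exists_mem_C_of_mem_Mix hp
  intro h
  rw [h] at hj
  exact Finset.disjoint_left.mp (disjoint_A_C n α p.2) hj hjC

/-- a `JM`-monomial is not a whole `C`-block. -/
lemma ne_C_of_mem_JM {s : Finset (I n)} (hs : s ∈ JM n) (β : Fin 2) : s ≠ C n β := by
  obtain ⟨p, hp⟩ := mem_JM.mp hs
  obtain ⟨i, hi, hiA⟩ := exists_mem_A_of_mem_Mix hp
  intro h
  rw [h] at hi
  exact Finset.disjoint_left.mp (disjoint_A_C n p.1 β) hiA hi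

/-- a `JM`-monomial lies in Part II's reduced index set `J`. -/
lemma mem_J_of_mem_JM {s : Finset (I n)} (hs : s ∈ JM n) : s ∈ J n := by
  obtain ⟨p, hp⟩ := mem_JM.mp hs
  exact mem_J.mpr ⟨Mix_subset_Rel hp, ne_A_of_mem_JM hs 1, ne_C_of_mem_JM hs 1⟩

open Classical in
/-- the LIVE mixed monomials: canonical coefficient non-zero. -/
noncomputable def JMc : Finset (Finset (I n)) := (JM n).filter fun s => c (αc s) (βc s) ≠ 0

open Classical in
/-- membership in the LIVE mixed family `JMc c`: in `JM` and the coefficient `c (αc s) (βc s)` is non-zero. -/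
lemma mem_JMc {s : Finset (I n)} : s ∈ JMc K (n := n) c ↔ s ∈ JM n ∧ c (αc s) (βc s) ≠ 0 := by
  unfold JMc
  rw [Finset.mem_filter]

/-- a live mixed monomial, as a member of `J`. -/
def jmJ (s : JMc K (n := n) c) : J n := ⟨s.1, mem_J_of_mem_JM ((mem_JMc K c).mp s.2).1⟩

/-- the inclusion `JMc c → J` is the identity on the underlying finset (definitional). -/
@[simp] lemma coe_jmJ (s : JMc K (n := n) c) : ((jmJ K c s : J n) : Finset (I n)) = s.1 := rfl

/-- the live mixed images `E_s ∧ v`. -/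
noncomputable def vecM (s : JMc K (n := n) c) : HT K n := vecJ K (hboxCoeff K (n := n) c) (jmJ K c s)

/-- the pivot coefficient of a relevant monomial against `hbox c` is non-zero when `c (αc s) (βc s) ≠ 0`. -/
lemma pivCoeff_hbox_ne_zero {k : ℕ} (s : Rel n k) (h : c (αc s.1) (βc s.1) ≠ 0) :
    pivCoeff K (hboxCoeff K (n := n) c) s ≠ 0 := by
  unfold pivCoeff hboxCoeff
  exact mul_ne_zero (mul_ne_zero h ((sgn_ne_zero_iff K).mpr (disjoint_A_C n _ _)))
    ((sgn_ne_zero_iff K).mpr (disjoint_P_canonical s.2))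

/-- the pivot coefficient of a relevant monomial against `hbox c` vanishes when `c (αc s) (βc s) = 0`. -/
lemma pivCoeff_hbox_eq_zero {k : ℕ} (s : Rel n k) (h : c (αc s.1) (βc s.1) = 0) :
    pivCoeff K (hboxCoeff K (n := n) c) s = 0 := by
  unfold pivCoeff hboxCoeff
  rw [h, zero_mul, zero_mul]

/-- the images of the live mixed monomials are linearly independent (`n > 0`). -/
theorem vecM_linearIndependent (hn : 0 < n) : LinearIndependent K (vecM K (n := n) c) := by
  apply LinearIndependent.of_pairwise_dual_eq_zero_one _
    (fun s => (pivCoeff K (hboxCoeff K (n := n) c) (jRel (jmJ K c s)))⁻¹ • (B K n).coord (piv (jRel (jmJ K c s))))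
  · intro s s' hss'
    rw [LinearMap.smul_apply, vecM, coord_piv_vecJ K _ hn, if_neg, smul_zero]
    intro h
    apply hss'
    have h2 : (s' : Finset (I n)) = (s : Finset (I n)) := congrArg (fun t : J n => (t : Finset (I n))) h
    exact (Subtype.ext h2).symm
  · intro s
    rw [LinearMap.smul_apply, vecM, coord_piv_vecJ K _ hn, if_pos rfl, smul_eq_mul]
    exact inv_mul_cancel₀ (pivCoeff_hbox_ne_zero K c (jRel (jmJ K c s)) ((mem_JMc K c).mp s.2).2)

/-- dimension of the live mixed span. -/
lemma finrank_span_vecM (hn : 0 < n) :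
    Module.finrank K (Submodule.span K (Set.range (vecM K (n := n) c))) = (JMc K (n := n) c).card := by
  rw [finrank_span_eq_card (vecM_linearIndependent K c hn), Fintype.card_coe]

/-! #### The three pieces of the range. -/

/-- the four triple monomial supports. -/
def Trip : Set (Finset (I n)) := {t | (∃ β, t = TA n β) ∨ ∃ α, t = TC n α}

/-- the pivot monomial of a `JM`-monomial is not one of the four triple monomials. -/
lemma piv_not_mem_Trip (s : J n) (hs : (s : Finset (I n)) ∈ JM n) : piv (jRel s) ∉ (Trip : Set (Finset (I n))) := by
  have hcard : (s : Finset (I n)).card = n := card_of_mem_Rel (mem_J.mp s.2).1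
  rintro (⟨β, h⟩ | ⟨α, h⟩)
  · exact ne_A_of_mem_JM hs _ (eq_A_of_union_eq_TA hcard h)
  · exact ne_C_of_mem_JM hs _ (eq_C_of_union_eq_TC hcard h)

/-- the live mixed span sits on the NON-triple monomials. -/
lemma span_vecM_le :
    Submodule.span K (Set.range (vecM K (n := n) c)) ≤ Submodule.span K ((B K n) '' (Trip (n := n))ᶜ) := by
  rw [Submodule.span_le]
  rintro _ ⟨s, rfl⟩
  have hs : (s.1 : Finset (I n)) ∈ JM n := ((mem_JMc K c).mp s.2).1
  obtain ⟨p, hp⟩ := mem_JM.mp hs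
  rw [SetLike.mem_coe, vecM, vecJ, vec_eq_of_mem_Mix K _ (jRel (jmJ K c s)) hp]
  exact Submodule.smul_mem _ _ (Submodule.subset_span ⟨_, piv_not_mem_Trip (jmJ K c s) hs, rfl⟩)

/-- `E_{A_a} ∧ v` lies in the plane of the two `A`-side triple monomials. -/
lemma vA_mem_span (hn : 0 < n) (a : Fin 2) :
    B K n (Apc n a : powersetCard (I n) n) * hbox K n c ∈
      Submodule.span K ((B K n) '' {t | ∃ β, t = TA n β}) := by
  have key : ∀ d : Fin 2 → K, ∑ β, d β • B K n (TA n β) ∈ Submodule.span K ((B K n) '' {t | ∃ β, t = TA n β}) :=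
    fun d => Submodule.sum_mem _ fun β _ => Submodule.smul_mem _ _ (Submodule.subset_span ⟨TA n β, ⟨β, rfl⟩, rfl⟩)
  fin_cases a
  · rw [show ((⟨0, by norm_num⟩ : Fin 2)) = 0 from rfl, vA_zero_eq K hn c]; exact key _
  · rw [show ((⟨1, by norm_num⟩ : Fin 2)) = 1 from rfl, vA_one_eq K hn c]; exact key _

/-- `E_{C b} ∧ hbox c` lies in the span of the two `C`-side triple monomials (`n > 0`). -/
lemma vC_mem_span (hn : 0 < n) (b : Fin 2) :
    B K n (Cpc n b : powersetCard (I n) n) * hbox K n c ∈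
      Submodule.span K ((B K n) '' {t | ∃ α, t = TC n α}) := by
  have key : ∀ d : Fin 2 → K, ∑ α, d α • B K n (TC n α) ∈ Submodule.span K ((B K n) '' {t | ∃ α, t = TC n α}) :=
    fun d => Submodule.sum_mem _ fun α _ => Submodule.smul_mem _ _ (Submodule.subset_span ⟨TC n α, ⟨α, rfl⟩, rfl⟩)
  fin_cases b
  · rw [show ((⟨0, by norm_num⟩ : Fin 2)) = 0 from rfl, vC_zero_eq K hn c]; exact key _
  · rw [show ((⟨1, by norm_num⟩ : Fin 2)) = 1 from rfl, vC_one_eq K hn c]; exact key _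

/-- the `A`-corner span. -/
noncomputable def RA : Submodule K (HT K n) :=
  Submodule.span K (Set.range fun a : Fin 2 => B K n (Apc n a : powersetCard (I n) n) * hbox K n c)

/-- the `C`-corner span. -/
noncomputable def RC : Submodule K (HT K n) :=
  Submodule.span K (Set.range fun b : Fin 2 => B K n (Cpc n b : powersetCard (I n) n) * hbox K n c)

/-- the `A`-corner span `RA c` lies in the span of the two `A`-side triple monomials. -/
lemma RA_le (hn : 0 < n) : RA K (n := n) c ≤ Submodule.span K ((B K n) '' {t | ∃ β, t = TA n β}) := by
  rw [RA, Submodule.span_le]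
  rintro _ ⟨a, rfl⟩
  exact vA_mem_span K c hn a

/-- the `C`-corner span `RC c` lies in the span of the two `C`-side triple monomials. -/
lemma RC_le (hn : 0 < n) : RC K (n := n) c ≤ Submodule.span K ((B K n) '' {t | ∃ α, t = TC n α}) := by
  rw [RC, Submodule.span_le]
  rintro _ ⟨b, rfl⟩
  exact vC_mem_span K c hn b

/-- the `A`-side and `C`-side triple supports form disjoint sets (`n > 0`). -/
lemma disjoint_TA_TC (hn : 0 < n) :
    Disjoint ({t | ∃ β, t = TA n β} : Set (Finset (I n))) {t | ∃ α, t = TC n α} := by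
  rw [Set.disjoint_left]
  rintro _ ⟨β, rfl⟩ ⟨α, h⟩
  exact TA_ne_TC hn α β h

/-- the `A`-side and `C`-side triple supports lie in `Trip`. -/
lemma TA_TC_subset_Trip :
    ({t | ∃ β, t = TA n β} : Set (Finset (I n))) ∪ {t | ∃ α, t = TC n α} ⊆ Trip (n := n) := by
  rintro t (h | h)
  · exact Or.inl h
  · exact Or.inr h

/-- the range is the sum of the three pieces. -/
lemma range_hbox_eq_sup :
    LinearMap.range (wedgeMap K n n (hbox K n c)) =
      Submodule.span K (Set.range (vecM K (n := n) c)) ⊔ (RA K (n := n) c ⊔ RC K (n := n) c) := by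
  apply le_antisymm
  · rw [range_hbox_eq, Submodule.span_le]
    rintro _ ⟨s, rfl⟩
    rw [SetLike.mem_coe]
    rcases mem_Rel.mp s.2 with ⟨p, hp⟩ | ⟨α, hα⟩ | ⟨β, hβ⟩
    · -- mixed: live or dead
      have hsJM : s.1 ∈ JM n := mem_JM.mpr ⟨p, hp⟩
      by_cases hc0 : c (αc s.1) (βc s.1) = 0
      · rw [vec_eq_of_mem_Mix K _ s hp, pivCoeff_hbox_eq_zero K c s hc0, zero_smul]
        exact Submodule.zero_mem _
      · refine Submodule.mem_sup_left (Submodule.subset_span ⟨⟨s.1, (mem_JMc K c).mpr ⟨hsJM, hc0⟩⟩, ?_⟩)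
        rw [vecM, vecJ]
        rfl
    · -- a whole A-block
      have hs : s.1 = A n α := by
        obtain ⟨hsub, hcard⟩ := mem_PureA.mp hα
        exact Finset.eq_of_subset_of_card_le hsub (by rw [card_A, hcard])
      have : vec K (hboxCoeff K (n := n) c) s = B K n (Apc n α : powersetCard (I n) n) * hbox K n c := by
        rw [← vec_A_eq K c α]; congr 1; exact Subtype.ext hs
      rw [this]
      exact Submodule.mem_sup_right (Submodule.mem_sup_left (Submodule.subset_span ⟨α, rfl⟩))
    · have hs : s.1 = C n β := by
        obtain ⟨hsub, hcard⟩ := mem_PureC.mp hβ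
        exact Finset.eq_of_subset_of_card_le hsub (by rw [card_C, hcard])
      have : vec K (hboxCoeff K (n := n) c) s = B K n (Cpc n β : powersetCard (I n) n) * hbox K n c := by
        rw [← vec_C_eq K c β]; congr 1; exact Subtype.ext hs
      rw [this]
      exact Submodule.mem_sup_right (Submodule.mem_sup_right (Submodule.subset_span ⟨β, rfl⟩))
  · rw [range_hbox_eq]
    refine sup_le ?_ (sup_le ?_ ?_)
    · rw [Submodule.span_le]
      rintro _ ⟨s, rfl⟩
      exact Submodule.subset_span ⟨jRel (jmJ K c s), rfl⟩
    · rw [RA, Submodule.span_le]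
      rintro _ ⟨a, rfl⟩
      rw [SetLike.mem_coe]
      change B K n (Apc n a : powersetCard (I n) n) * hbox K n c ∈ _
      rw [← vec_A_eq K c a]
      exact Submodule.subset_span ⟨_, rfl⟩
    · rw [RC, Submodule.span_le]
      rintro _ ⟨b, rfl⟩
      rw [SetLike.mem_coe]
      change B K n (Cpc n b : powersetCard (I n) n) * hbox K n c ∈ _
      rw [← vec_C_eq K c b]
      exact Submodule.subset_span ⟨_, rfl⟩

/-- finite-dimensionality bookkeeping: `dim(U ⊔ V) = dim U + dim V` for disjoint `U, V`. -/
lemma finrank_sup_of_disjoint {U V : Submodule K (HT K n)} (h : Disjoint U V) :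
    Module.finrank K ↥(U ⊔ V) = Module.finrank K U + Module.finrank K V := by
  have := Submodule.finrank_sup_add_finrank_inf_eq U V
  rw [disjoint_iff.mp h, finrank_bot, add_zero] at this
  exact this

/-- STRUCTURE OF THE RANGE: `dim = #(live mixed) + dim(A-corner span) + dim(C-corner span)`. -/
theorem finrank_range_hbox_eq_three (hn : 0 < n) :
    Module.finrank K (LinearMap.range (wedgeMap K n n (hbox K n c))) =
      (JMc K (n := n) c).card + Module.finrank K (RA K (n := n) c) + Module.finrank K (RC K (n := n) c) := by
  have hB := (B K n).linearIndependent
  have hd1 : Disjoint (Submodule.span K (Set.range (vecM K (n := n) c))) (RA K (n := n) c ⊔ RC K (n := n) c) := by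
    refine Disjoint.mono (span_vecM_le K c) ?_ (hB.disjoint_span_image disjoint_compl_left)
    refine (sup_le ((RA_le K c hn).trans ?_) ((RC_le K c hn).trans ?_))
    · exact Submodule.span_mono (Set.image_mono (Set.subset_union_left.trans TA_TC_subset_Trip))
    · exact Submodule.span_mono (Set.image_mono (Set.subset_union_right.trans TA_TC_subset_Trip))
  have hd2 : Disjoint (RA K (n := n) c) (RC K (n := n) c) :=
    Disjoint.mono (RA_le K c hn) (RC_le K c hn) (hB.disjoint_span_image (disjoint_TA_TC hn))
  rw [range_hbox_eq_sup K c, finrank_sup_of_disjoint K hd1, finrank_sup_of_disjoint K hd2,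
    finrank_span_vecM K c hn, add_assoc]

end GeneralPattern

end Summit.Ventures.HSemireg.WedgeBox
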